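import Summits.PneNP.PneNP.Theses.PhaseTwins
import Summits.PneNP.PneNP.Theorems.PhaseTwinsPolyDepthTwinsAboveDefs
import Summits.PneNP.PneNP.Theorems.PhaseTwinsPolyDepthTwinsAboveMaxDegree
import Summits.PneNP.PneNP.Theorems.PhaseTwinsPolyDepthTwinsAboveDuplicator
import Summits.PneNP.PneNP.Theorems.PhaseTwinsPolyDepthTwinsAboveChargeVisible
import Summits.PneNP.PneNP.Theorems.PhaseTwinsPolyDepthTwinsAboveTseitinGap
import Summits.PneNP.PneNP.Theorems.PhaseTwinsPolyDepthTwinsAboveParameters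
import Summits.PneNP.PneNP.Theorems.PhaseTwinsPolyDepthTwinsAboveConnector
import Literature.Computability.Complexity.HardcoreInapproximability
import Literature.ModelTheory.FiniteModelTheory.CFIMatchingGraphs
import Literature.ModelTheory.FiniteModelTheory.CkEquivHomCount
import Literature.ModelTheory.FiniteModelTheory.CkEquivTransfer
import Literature.ModelTheory.FiniteModelTheory.CountingWidthProofs

/-!
# Line `parity-wired-ports` for crux `PhaseTwins.PolyDepthTwinsAbove` (stmt-PneNP-2719)

Skeleton (crux-plan, planner-cruxplan-stmt-PneNP-2719-parity-wired-ports-0, 2026-08-15) of the crux idea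
`parity-wired-ports` (crux-ideate r1 k1; triage r1-1: pass), with both triage sharpenings built in:
(i) the FIRST lemma is the finite identity behind charge visibility for the EXACT connector used here
(`stub_chargeVisible`), the gauge/shift-equivariance feeds the Duplicator stub, and the Lemma-2.2 analogue
for port wirings is its own stub (`stub_connector`); (ii) the base is 3-regular (`r = 3`, the tree's
`CFIMatching.base3` expanders) — no even-arity restriction, connectors of degree `3`.

THE LINE (CFI/Tseitin charge twins wired DIRECTLY into the port layer of Sly's phase gadgets; no 3XOR →
MAX-CUT chain, no `gadgetSubst` with name-reserved ports — that wiring is 1-WL-separable, evidence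
cruxideate-1 / kit j005776). Data: a 3-regular rotation map `R` on `Fin M` without half-edges (an
`η`-edge-expander), charges `c : Fin M → ZMod 2`, and ONE Sly gadget `(G, W±, V±)` on `Fin v` with `m` ports of
each sign (`slyGadgetReduction`: `(GpropA)`, `(GpropB)` with parameters `0 < q⁻ < q⁺ < 1`). The graph
`pwGraph R W c` (vertex type `PWVert M v κ₂`, uniform in `R` and `c`) has
* a gadget COPY `g_{δ,a}` for every dart `δ` and bit `a : ZMod 2` (only canonical darts — one per edge — are
  wired; the other copies are isolated junk, identical on both sides);
* PAIR COUPLING: for each canonical dart `δ`, `κ₁` Sly port–port edges `V⁺–V⁺` and `κ₁` edges `V⁻–V⁻` between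
  `g_{δ,0}` and `g_{δ,1}` (same slot on both sides) — by Sly's Lemma 2.2 arithmetic each anti-aligned pair
  (phases `Y(g_{δ,0}) ≠ Y(g_{δ,1})`) gains the factor `B^{κ₁}`, `B = slyB q⁺ q⁻ > 1`, so dominant
  configurations are "off-diagonal" and carry one `ZMod 2` spin `b_δ` per edge (which copy is in phase `+`);
* PARITY CONNECTORS: for each base vertex `w` and `j < κ₂`, the ten-vertex Cai–Fürer–Immerman inner/end
  complex of `CFIMatching.mgraph` (4 inner vertices `(w, S', j)`, `S' : Fin 2 → ZMod 2`, 6 end vertices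
  `(w, i, a, j)`, inner–end adjacency `bit (c w) S' i = a`), whose end vertex `(w, i, a, j)` is plugged into ONE
  `V⁺` port of the copy `g_{canon(w,i), a}`.
Mechanism. GAUGE: flipping `a ↦ a + g δ` on copies/ends and `S' ↦ S' + g|_w` on inner vertices is an
isomorphism `pwGraph R W c ≅ pwGraph R W (c + ∂g)` (`CFIMatching.bit_shift`), adjacency sees `c` only at inner
vertices, each vertex needs `≤ 6` darts ⇒ Duplicator wins the bijective `K`-pebble game between ANY two charge
vectors when `6K < ηM` (`stub_duplicator`, the `ckEquiv_mgraph` template verbatim). ENERGY: by `(GpropB)` the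
ports are product-Bernoulli given the phases, so `Z(pwGraph c; phases = Y) = (1 ± ε) · pwW c Y · Z(copies; Y)`
with an EXPLICIT weight `pwW` (`stub_connector`, Sly Lemma 2.2 for this wiring); in the off-diagonal sector the
complex at `w` contributes `F_{c w + ∂b(w)}(λ; 1-q⁺, 1-q⁻)` (Tseitin covariance of the CFI complex), and the
exact identity `F₀ − F₁ = λ⁴ (q⁺ − q⁻)³ > 0` (kit j007440/j007445, sympy, all `0 < q⁻ < q⁺`, `λ > 0`;
`stub_chargeVisible`) makes SATISFIED local parity strictly favoured; total parity `Σ_w (c w + ∂b w) = Σ c`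
forces ≥ 1 violated vertex iff `Σ c = 1`, so `max_Y pwW (1_{w₀}) Y ≤ e^{-κ₂ g} max_Y pwW 0 Y`,
`g = Ψ(0) − Ψ(1) > 0`, once the pair coupling dominates (`κ₁ log B ≥ κ₂ (M log ρ_F + g)`, `stub_tseitinGap`);
with `(GpropA)` (phase entropy `n^{-6M}`) and `e^{κ₂ g} ≥ 6 n^{6M}` this gives `Z(pwGraph 0) ≥ 2 Z(pwGraph 1_{w₀})`
(`twins_of_estimates`, PROVED here = Sly's proof of Thm 1 run for two charge classes). PARAMETERS
(`stub_parameters`, asymptotic arithmetic): `M = m₀·2(d₀+1)` (order of `base3`), `n = M^k` (`k ≈ 8/θ`),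
`κ₁ = slyK θ n = ⌊n^{3θ/4}⌋`, `κ₂ = ⌊n^{θ/4}⌋`, `K = ⌊ηM/7⌋`; then `N = |PWVert| = 6Mv + 10Mκ₂ ≤ 28 M^{k+1}` and
`K ≥ N^{θ'}`, `θ' = 1/(2k+2)`. The composition `PolyDepthTwinsAbove_of` (kernel-checked, no sorry of its own)
transports to `Fin N` (`CkEquiv.iso_congr`, `Iso.maxDegree_eq`, `independencePolynomial_map_equiv`) and converts
`≡_{C^K}` into the typed hom-count clause by the PROVED Dvořák bridge `Dvorak2010.homCount_eq_of_ckEquiv`.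

Status (lead prover-line-stmt-PneNP-2719-r-0, 2026-08-16): the six provable stubs are LANDED as separate modules
(`…MaxDegree` p74817, `…Duplicator` p74939, `…ChargeVisible` p75254, `…Parameters` p75857, `…TseitinGap` p76373,
`…Connector` = Sly's Lemma 2.2 for this wiring, parts `…ConnectorFibres/Indep/Decomp/Expect/Connector`) and imported
here; the remaining hypothesis is S1 = Sly 2010 Theorem 2.1 derandomised (the `h21` of the tree's
`slyGadgetReduction_of_gadgets`, i.e. the named fact `Literature.Computability.Complexity.slyGadgetReduction`), so this
file proves the crux CONDITIONALLY: `PolyDepthTwinsAbove_of_slyGadgets` (hypothesis: the gadget theorem) and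
`PolyDepthTwinsAbove_of_slyGadgetReduction : slyGadgetReduction → PolyDepthTwinsAbove`. Disproof.lean (cdisprove
gen-2) audited all seven stubs: none false as typed; `stub_tseitinGap` brute-forced tight.
-/

noncomputable section

open scoped Classical BigOperators

namespace Summit.PneNP.PneNP.Cruxes.PolyDepthTwinsAbove.ParityWiredPorts

open Finset
open Literature.Computability.Complexity (hardcoreZOn slyPhase SlyPropA SlyPropB slyB slyM slyK
  slyGadgetReduction one_lt_slyB sum_hardcoreZOn_fiber le_and_le_of_abs_sub_le hardcoreZOn_nonneg
  hardcoreZOn_le_independencePolynomial)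
open Literature.Computability.Complexity.Expander (RotGraph)
open Literature.ModelTheory.FiniteModelTheory (CkEquiv)
open Literature.ModelTheory.FiniteModelTheory.TseitinColouring (Dart EdgeExpansion bd Params zigzagParams)
open Literature.ModelTheory.FiniteModelTheory.CFIMatching (bit Canon NoFixed base3 η₃ edgeExpansion_base3
  noFixed_base3 η₃_pos)
open Literature.Probability.LatticeModels (independencePolynomial hardCoreThreshold hardCoreThreshold_pos
  independencePolynomial_pos)
open Literature.Combinatorics.SimpleGraph (treewidth)
open Summit.PneNP.PneNP.Theses.PhaseTwins (PolyDepthTwinsAbove)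

set_option linter.unusedVariables false
set_option linter.dupNamespace false

variable {M v m κ₁ κ₂ : ℕ}

/-! ## The construction

The objects (`PWVert`, `Wiring`, `slotEmb`, `canonEnd`, `pwRel`/`pwGraph`, `pwBaseRel`/`pwBase`, `copyFib`,
`pwPhase`, `occP`, `occM`, `pairW`, `CxVert`/`cxRel`/`cxGraph`/`cxWeight`/`cxW`, `pwW`, `pwPsi`, `cxRho`, `PWCutEstimate`)
are LANDED in `Summits/PneNP/PneNP/Theorems/PhaseTwinsPolyDepthTwinsAboveDefs.lean` (p72174, same namespace) and
imported here; every stub file imports that module. -/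

/-! ## The stubs -/

-- S1 `stub_slyGadgets` (Sly 2010 Thm 2.1 derandomised): NOT provable here; it is the HYPOTHESIS of the composition below.


/-- S1 is exactly what the named fact `slyGadgetReduction` provides (PROVED: the fact implies the gadget
hypothesis; the converse is the tree's `slyGadgetReduction_of_gadgets`). -/
theorem slyGadgets_of_slyGadgetReduction (h : slyGadgetReduction) : ∀ Δ : ℕ, 3 ≤ Δ → ∀ lam : ℝ, hardCoreThreshold Δ < lam →
    ∃ d : ℕ, 3 ≤ d ∧ d ≤ Δ ∧ hardCoreThreshold d < lam ∧
    ∃ θ qp qm : ℝ, 0 < θ ∧ θ < 1 / 8 ∧ 0 < qm ∧ qm < qp ∧ qp < 1 ∧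
      ∃ n₁ : ℕ, ∀ n : ℕ, n₁ ≤ n →
        ∃ (v : ℕ) (G : SimpleGraph (Fin v)) (Wp Wm : Finset (Fin v))
          (Vp Vm : Fin (slyM d θ n) ↪ Fin v),
          (v : ℝ) ≤ 3 * n ∧ G.maxDegree ≤ d ∧ Disjoint Wp Wm ∧
            Disjoint (Set.range Vp) (Set.range Vm) ∧
            (∀ i, G.degree (Vp i) ≤ d - 1) ∧ (∀ i, G.degree (Vm i) ≤ d - 1) ∧
            SlyPropA G lam Wp Wm n ∧
            SlyPropB G lam Wp Wm Vp Vm qp qm ((n : ℝ) ^ (-(2 * θ))) := by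
  intro Δ hΔ lam hlam
  obtain ⟨d, hd3, hdΔ, hdlam, θ, qp, qm, hθ, hθ8, hqm, hlt, hqp, hmain⟩ := h Δ hΔ lam hlam
  obtain ⟨n₁, hn₁⟩ := hmain (1 / 2) (by norm_num)
  refine ⟨d, hd3, hdΔ, hdlam, θ, qp, qm, hθ, hθ8, hqm, hlt, hqp, n₁, fun n hn => ?_⟩
  obtain ⟨v, G, Wp, Wm, Vp, Vm, hv, hdeg, hW, hVV, hdp, hdm, hA, hB, -⟩ := hn₁ n hn
  exact ⟨v, G, Wp, Wm, Vp, Vm, hv, hdeg, hW, hVV, hdp, hdm, hA, hB⟩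

-- S2 `stub_chargeVisible`: LANDED (p75254, `Summits.PneNP.PneNP.Theorems.PhaseTwinsPolyDepthTwinsAboveChargeVisible`).

-- S3 `stub_maxDegree`: LANDED (p74817, `Summits.PneNP.PneNP.Theorems.PhaseTwinsPolyDepthTwinsAboveMaxDegree`).

-- S4 `stub_duplicator`: LANDED (p74939, `Summits.PneNP.PneNP.Theorems.PhaseTwinsPolyDepthTwinsAboveDuplicator`).

-- S5 `stub_connector`: LANDED (`Summits.PneNP.PneNP.Theorems.PhaseTwinsPolyDepthTwinsAboveConnector`).

-- S6 `stub_tseitinGap`: LANDED (`Summits.PneNP.PneNP.Theorems.PhaseTwinsPolyDepthTwinsAboveTseitinGap`).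

-- S7 `stub_parameters`: LANDED (p75857, `Summits.PneNP.PneNP.Theorems.PhaseTwinsPolyDepthTwinsAboveParameters`).

/-! ## Proved glue -/

-- `pwW_nonneg`: in `…Connector`.

/-- **Sly's proof of Theorem 1 run for two charge classes** (PROVED): from the two `PWCutEstimate`s (relative
error `1/2`), the weight gap `pwW c' Y · T ≤ pwW c Y₀` and `T ≥ 6 n^{6M}` (phase entropy), `2 Z(pwGraph c') ≤
Z(pwGraph c)`: `Z(c') = Σ_Y Z_{c'}(Y) ≤ (3/2)(pwW c Y₀/T) Z_{base}` and
`Z(c) ≥ Z_c(Y₀) ≥ (1/2) pwW c Y₀ · n^{-6M} Z_{base}`. -/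
theorem twins_of_estimates (R : RotGraph M 3) (W : Wiring v m κ₁ κ₂) {lam qp qm : ℝ} (hlam : 0 ≤ lam)
    {n : ℕ} (hn : 0 < n) (c c' : Fin M → ZMod 2) (hW : ∀ Y, 0 ≤ pwW R lam qp qm κ₁ κ₂ c Y)
    (hc : PWCutEstimate R W lam qp qm (1 / 2) n c) (hc' : PWCutEstimate R W lam qp qm (1 / 2) n c')
    {T : ℝ} (hT : 6 * (n : ℝ) ^ (6 * M) ≤ T)
    (hgap : ∃ Y₀, ∀ Y, pwW R lam qp qm κ₁ κ₂ c' Y * T ≤ pwW R lam qp qm κ₁ κ₂ c Y₀) :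
    2 * independencePolynomial (pwGraph R W c') lam ≤ independencePolynomial (pwGraph R W c) lam := by
  obtain ⟨Y₀, hY₀⟩ := hgap
  set Zb : (Dart M 3 × ZMod 2 → Bool) → ℝ :=
    fun Y => hardcoreZOn (pwBase M κ₂ W) lam (fun I => pwPhase W I = Y) with hZb
  set W0 : (Dart M 3 × ZMod 2 → Bool) → ℝ := pwW R lam qp qm κ₁ κ₂ c with hW0
  set W1 : (Dart M 3 × ZMod 2 → Bool) → ℝ := pwW R lam qp qm κ₁ κ₂ c' with hW1
  set Zbase : ℝ := independencePolynomial (pwBase M κ₂ W) lam with hZbase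
  have hnR : (0 : ℝ) < n := by exact_mod_cast hn
  have hP : (0 : ℝ) < (n : ℝ) ^ (6 * M) := pow_pos hnR _
  have hP6 : (0 : ℝ) < 6 * (n : ℝ) ^ (6 * M) := by positivity
  have hTpos : 0 < T := lt_of_lt_of_le hP6 hT
  have hZb0 : ∀ Y, 0 ≤ Zb Y := fun Y => hardcoreZOn_nonneg _ hlam _
  have hZbase0 : 0 ≤ Zbase := (independencePolynomial_pos _ hlam).le
  have hW00 : 0 ≤ W0 Y₀ := hW Y₀
  -- upper bound for `c'`
  have hup : independencePolynomial (pwGraph R W c') lam ≤ 3 / 2 * (W0 Y₀ / T) * Zbase := by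
    rw [hZbase, ← sum_hardcoreZOn_fiber (pwGraph R W c') lam (pwPhase W),
      ← sum_hardcoreZOn_fiber (pwBase M κ₂ W) lam (pwPhase W), Finset.mul_sum]
    refine Finset.sum_le_sum fun Y _ => ?_
    have h1 := (le_and_le_of_abs_sub_le (hc' Y).2).2
    have h2 : W1 Y ≤ W0 Y₀ / T := by
      rw [le_div_iff₀ hTpos]; exact hY₀ Y
    calc hardcoreZOn (pwGraph R W c') lam (fun I => pwPhase W I = Y)
        ≤ (1 + 1 / 2) * (W1 Y * Zb Y) := h1
      _ ≤ (1 + 1 / 2) * (W0 Y₀ / T * Zb Y) := by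
          have := mul_le_mul_of_nonneg_right h2 (hZb0 Y)
          nlinarith
      _ = 3 / 2 * (W0 Y₀ / T) * Zb Y := by ring
  -- lower bound for `c`
  have hlo : 1 / 2 * W0 Y₀ * (((n : ℝ) ^ (6 * M))⁻¹ * Zbase) ≤
      independencePolynomial (pwGraph R W c) lam := by
    have h1 := (le_and_le_of_abs_sub_le (hc Y₀).2).1
    have h2 := (hc Y₀).1
    calc 1 / 2 * W0 Y₀ * (((n : ℝ) ^ (6 * M))⁻¹ * Zbase) ≤ 1 / 2 * W0 Y₀ * Zb Y₀ :=
          mul_le_mul_of_nonneg_left h2 (by positivity)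
      _ = (1 - 1 / 2) * (W0 Y₀ * Zb Y₀) := by ring
      _ ≤ hardcoreZOn (pwGraph R W c) lam (fun I => pwPhase W I = Y₀) := h1
      _ ≤ independencePolynomial (pwGraph R W c) lam := hardcoreZOn_le_independencePolynomial _ hlam _
  -- combine
  have hX : 0 ≤ 3 * W0 Y₀ * Zbase := by positivity
  calc 2 * independencePolynomial (pwGraph R W c') lam ≤ 2 * (3 / 2 * (W0 Y₀ / T) * Zbase) :=
        mul_le_mul_of_nonneg_left hup (by norm_num)
    _ = 3 * W0 Y₀ * Zbase / T := by ring
    _ ≤ 3 * W0 Y₀ * Zbase / (6 * (n : ℝ) ^ (6 * M)) := div_le_div_of_nonneg_left hX hP6 hT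
    _ = 1 / 2 * W0 Y₀ * (((n : ℝ) ^ (6 * M))⁻¹ * Zbase) := by
        field_simp
        ring
    _ ≤ independencePolynomial (pwGraph R W c) lam := hlo

/-- The independence polynomial is invariant under transport along a bijection of the vertices. -/
theorem independencePolynomial_map_equiv {α β : Type*} [Fintype α] [DecidableEq α] [Fintype β]
    [DecidableEq β] (G : SimpleGraph α) (e : α ≃ β) (lam : ℝ) :
    independencePolynomial (G.map e.toEmbedding) lam = independencePolynomial G lam := by
  have hadj : ∀ a b : α, (G.map e.toEmbedding).Adj (e.toEmbedding a) (e.toEmbedding b) ↔ G.Adj a b :=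
    fun a b => SimpleGraph.map_adj_apply
  have hind : ∀ I : Finset α,
      (G.map e.toEmbedding).IsIndepSet (↑(I.map e.toEmbedding) : Set β) ↔ G.IsIndepSet (↑I : Set α) := by
    intro I
    constructor
    · intro h a ha b hb hab
      have hab' : e.toEmbedding a ≠ e.toEmbedding b := fun h' => hab (e.injective h')
      have := h (Finset.mem_coe.2 (Finset.mem_map_of_mem _ (Finset.mem_coe.1 ha)))
        (Finset.mem_coe.2 (Finset.mem_map_of_mem _ (Finset.mem_coe.1 hb))) hab'
      exact fun hG => this ((hadj a b).2 hG)
    · intro h x hx y hy hxy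
      obtain ⟨a, ha, rfl⟩ := Finset.mem_map.1 (Finset.mem_coe.1 hx)
      obtain ⟨b, hb, rfl⟩ := Finset.mem_map.1 (Finset.mem_coe.1 hy)
      exact fun hG => h (Finset.mem_coe.2 ha) (Finset.mem_coe.2 hb) (fun hab => hxy (by rw [hab]))
        ((hadj a b).1 hG)
  unfold independencePolynomial
  symm
  refine Fintype.sum_equiv (Equiv.finsetCongr e) _ _ fun I => ?_
  rw [Equiv.finsetCongr_apply, Finset.card_map]
  by_cases hI : G.IsIndepSet (↑I : Set α)
  · rw [if_pos hI, if_pos ((hind I).2 hI)]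
  · rw [if_neg hI, if_neg (fun h => hI ((hind I).1 h))]

/-- Transport of a degree bound along an isomorphism, for ANY decidability instances (the crux statement
carries the classical ones). -/
theorem maxDegree_le_of_iso {α β : Type*} [Fintype α] [Fintype β] {G : SimpleGraph α} {H : SimpleGraph β}
    {iG : DecidableRel G.Adj} {iH : DecidableRel H.Adj} (f : G ≃g H) {Δ : ℕ}
    (h : @SimpleGraph.maxDegree α G _ iG ≤ Δ) : @SimpleGraph.maxDegree β H _ iH ≤ Δ := by
  have := f.maxDegree_eq
  rw [← this]; exact h

/-- The route's inlined sum IS `independencePolynomial`, for ANY decidability instances. -/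
theorem indepSum_eq {α : Type*} [Fintype α] [DecidableEq α] (G : SimpleGraph α) {iG : DecidableRel G.Adj}
    {dI : ∀ I : Finset α, Decidable (G.IsIndepSet (↑I : Set α))} (lam : ℝ) :
    (∑ I : Finset α, @ite ℝ (G.IsIndepSet (↑I : Set α)) (dI I) (lam ^ I.card) 0) =
      @independencePolynomial α _ _ G iG ℝ _ lam := by
  unfold independencePolynomial
  exact Finset.sum_congr rfl fun I _ => by congr

/-- The number of vertices of the parity-wired graph. -/
theorem card_PWVert (M v κ₂ : ℕ) : Fintype.card (PWVert M v κ₂) = 6 * M * v + 10 * M * κ₂ := by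
  simp only [PWVert, Fintype.card_sum, Fintype.card_prod, Fintype.card_fin, ZMod.card, Fintype.card_fun]
  ring

/-! ## The composition (kernel-checked, no `sorry` of its own) -/

/-- **`PolyDepthTwinsAbove` from Sly's gadget theorem (S1) and the six landed stubs** (CONDITIONAL on the
hypothesis `stub_slyGadgets` = Sly 2010 Thm 2.1 derandomised, the `h21` of `slyGadgetReduction_of_gadgets`). Given `Δ ≥ 3` and `λ > λ_c(Δ)`: S1 gives `d, θ, q±` and,
for large `n`, a gadget; S2 gives `g > 0`; S7 fixes `θ'` and, for every `n₀`, parameters `M, n, κ₁, κ₂, K`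
satisfying all side conditions; the base is `base3 (zigzagParams.R m₀)` (`η₃`-edge-expander, no half-edges,
PROVED in tree); the twins are `pwGraph R W 0` and `pwGraph R W 1_{w₀}` transported to `Fin N`,
`N = 6Mv + 10Mκ₂`: degree by S3 + `Iso.maxDegree_eq`; `≡_{C^K}` by S4 + `CkEquiv.iso_congr`, turned into the
hom-count clause for treewidth `< N^{θ'} ≤ K` by `Dvorak2010.homCount_eq_of_ckEquiv` (PROVED bridge); the
factor-2 gap by S5 (twice) + S6 + `twins_of_estimates` + `independencePolynomial_map_equiv`. -/
theorem PolyDepthTwinsAbove_of_slyGadgets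
    (stub_slyGadgets : ∀ Δ : ℕ, 3 ≤ Δ → ∀ lam : ℝ, hardCoreThreshold Δ < lam →
    ∃ d : ℕ, 3 ≤ d ∧ d ≤ Δ ∧ hardCoreThreshold d < lam ∧
    ∃ θ qp qm : ℝ, 0 < θ ∧ θ < 1 / 8 ∧ 0 < qm ∧ qm < qp ∧ qp < 1 ∧
      ∃ n₁ : ℕ, ∀ n : ℕ, n₁ ≤ n →
        ∃ (v : ℕ) (G : SimpleGraph (Fin v)) (Wp Wm : Finset (Fin v))
          (Vp Vm : Fin (slyM d θ n) ↪ Fin v),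
          (v : ℝ) ≤ 3 * n ∧ G.maxDegree ≤ d ∧ Disjoint Wp Wm ∧
            Disjoint (Set.range Vp) (Set.range Vm) ∧
            (∀ i, G.degree (Vp i) ≤ d - 1) ∧ (∀ i, G.degree (Vm i) ≤ d - 1) ∧
            SlyPropA G lam Wp Wm n ∧
            SlyPropB G lam Wp Wm Vp Vm qp qm ((n : ℝ) ^ (-(2 * θ)))) :
    PolyDepthTwinsAbove := by
  intro Δ hΔ lam hlam
  have hlam' : hardCoreThreshold Δ < lam := hlam
  obtain ⟨d, hd3, hdΔ, hdlam, θ, qp, qm, hθ, hθ8, hqm, hlt, hqp, nA, hnA⟩ := stub_slyGadgets Δ hΔ lam hlam'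
  have hlam0 : 0 < lam := (hardCoreThreshold_pos hd3).trans hdlam
  obtain ⟨nB, hnB⟩ := stub_connector (ε := 1 / 2) hθ (by norm_num) hqm hlt hqp
  -- constants of the line
  have hη : 0 < η₃ zigzagParams.η zigzagParams.d := η₃_pos zigzagParams.η_pos zigzagParams.d
  have hg : 0 < pwPsi lam qp qm 0 - pwPsi lam qp qm 1 := sub_pos.2 (stub_chargeVisible hlam0 hqm hlt hqp)
  have hLB : 0 < Real.log (slyB qp qm) := Real.log_pos (one_lt_slyB hqm hlt hqp)
  obtain ⟨θ', hθ', k, hk⟩ := stub_parameters hθ hθ8 hη hg hLB (Real.log (cxRho lam qp qm)) hd3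
    zigzagParams.d (max nA nB)
  refine ⟨θ', hθ', fun n₀ => ?_⟩
  obtain ⟨m₁, hm₁⟩ := hk n₀
  -- the parameters
  let M : ℕ := m₁ * 2 * (zigzagParams.d + 1)
  let n : ℕ := M ^ k
  let κ₁ : ℕ := slyK θ n
  let κ₂ : ℕ := ⌊(n : ℝ) ^ (θ / 4)⌋₊
  let K : ℕ := ⌊η₃ zigzagParams.η zigzagParams.d * M / 7⌋₊
  obtain ⟨h1, h2, h3, h4, h5, h6, h7, h8, h9, h10, h11⟩ :=
    hm₁ m₁ le_rfl M n κ₁ κ₂ K rfl rfl rfl rfl rfl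
  -- the base: 3-regular η₃-edge-expander on `M` vertices without half-edges (PROVED in tree)
  let R : RotGraph M 3 := base3 (zigzagParams.R m₁)
  have hexp : EdgeExpansion R (η₃ zigzagParams.η zigzagParams.d) :=
    edgeExpansion_base3 _ (zigzagParams.expands m₁)
  have hNF : NoFixed R := noFixed_base3 _
  have hMpos : 0 < M := by omega
  have hnpos : 0 < n := pow_pos hMpos k
  -- the gadget at `n`
  obtain ⟨v, G, Wp, Wm, Vp, Vm, hv, hdeg, -, hVV, hdp, hdm, hA, hB⟩ :=
    hnA n ((le_max_left nA nB).trans h1)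
  -- the wiring and the two graphs
  let W : Wiring v (slyM d θ n) κ₁ κ₂ := ⟨G, Wp, Wm, Vp, Vm, slotEmb h2⟩
  let w₀ : Fin M := ⟨0, hMpos⟩
  let X : SimpleGraph (PWVert M v κ₂) := pwGraph R W 0
  let X' : SimpleGraph (PWVert M v κ₂) := pwGraph R W (Pi.single w₀ 1)
  let N : ℕ := Fintype.card (PWVert M v κ₂)
  have hNcard : N = 6 * M * v + 10 * M * κ₂ := card_PWVert M v κ₂
  let e : PWVert M v κ₂ ≃ Fin N := Fintype.equivFin (PWVert M v κ₂)
  -- the estimates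
  have hcut0 : PWCutEstimate R W lam qp qm (1 / 2) n 0 :=
    hnB n ((le_max_right nA nB).trans h1) R W hlam0.le h3 hA hB 0
  have hcut1 : PWCutEstimate R W lam qp qm (1 / 2) n (Pi.single w₀ 1) :=
    hnB n ((le_max_right nA nB).trans h1) R W hlam0.le h3 hA hB _
  have hgap : ∃ Y₀ : Dart M 3 × ZMod 2 → Bool, ∀ Y : Dart M 3 × ZMod 2 → Bool,
      pwW R lam qp qm κ₁ κ₂ (Pi.single w₀ 1) Y *
          Real.exp (κ₂ * (pwPsi lam qp qm 0 - pwPsi lam qp qm 1)) ≤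
        pwW R lam qp qm κ₁ κ₂ 0 Y₀ :=
    stub_tseitinGap hNF hlam0 hqm hlt hqp (stub_chargeVisible hlam0 hqm hlt hqp).le h4 w₀
  have htwins : 2 * independencePolynomial X' lam ≤ independencePolynomial X lam :=
    twins_of_estimates R W hlam0.le hnpos 0 (Pi.single w₀ 1)
      (fun Y => pwW_nonneg R hlam0.le hqm.le (hlt.le.trans hqp.le) (hqm.le.trans hlt.le) hqp.le κ₁ κ₂ 0 Y)
      hcut0 hcut1 h5 hgap
  have hck : CkEquiv K X X' := stub_duplicator hexp h7 W 0 (Pi.single w₀ 1) h6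
  have hdegX : X.maxDegree ≤ Δ := stub_maxDegree R W 0 hΔ hdΔ hdeg hVV hdp hdm
  have hdegX' : X'.maxDegree ≤ Δ := stub_maxDegree R W _ hΔ hdΔ hdeg hVV hdp hdm
  refine ⟨N, X.map e.toEmbedding, X'.map e.toEmbedding, ?_, ?_, ?_, ?_, ?_⟩
  · -- order `≥ n₀`
    have hMN : M ≤ N := by
      rw [hNcard]
      calc M = M * 1 := (mul_one M).symm
        _ ≤ 10 * M * κ₂ := Nat.mul_le_mul (Nat.le_mul_of_pos_left M (by norm_num)) h9
        _ ≤ 6 * M * v + 10 * M * κ₂ := Nat.le_add_left _ _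
    exact h10.trans hMN
  · -- maximum degree of the first twin
    exact maxDegree_le_of_iso (SimpleGraph.Iso.map e X) hdegX
  · -- maximum degree of the second twin
    exact maxDegree_le_of_iso (SimpleGraph.Iso.map e X') hdegX'
  · -- homomorphism indistinguishability below treewidth `N ^ θ' ≤ K`
    intro mF F hF
    have hNK : ((N : ℕ) : ℝ) ^ θ' ≤ K := by
      rw [hNcard]; exact h11 v hv
    have hKF : (treewidth F : ℝ) < K := hF.trans_le hNK
    have hKF' : treewidth F < K := by exact_mod_cast hKF
    have hck' : CkEquiv K (X.map e.toEmbedding) (X'.map e.toEmbedding) :=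
      hck.iso_congr (SimpleGraph.Iso.map e X) (SimpleGraph.Iso.map e X')
    exact Literature.ModelTheory.FiniteModelTheory.Dvorak2010.homCount_eq_of_ckEquiv h8 hck' F hKF'
  · -- the factor-2 gap, transported to `Fin N`
    have hZ := htwins
    rw [← independencePolynomial_map_equiv X e lam, ← independencePolynomial_map_equiv X' e lam] at hZ
    convert hZ using 2 <;> exact indepSum_eq _ _

/-- **The crux from the named fact** (CONDITIONAL RESULT): Sly's gadget reduction `slyGadgetReduction`
(Sly 2010 Thm 2.1 + Lemma 2.2; GŠV16 Lemma 19) implies `PolyDepthTwinsAbove`. -/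
theorem PolyDepthTwinsAbove_of_slyGadgetReduction (h : slyGadgetReduction) : PolyDepthTwinsAbove :=
  PolyDepthTwinsAbove_of_slyGadgets (slyGadgets_of_slyGadgetReduction h)

end Summit.PneNP.PneNP.Cruxes.PolyDepthTwinsAbove.ParityWiredPorts
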